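import Summits.BirchSwinnertonDyer.BirchSwinnertonDyer.Theorems.BiquadraticEisensteinDescentHeegnerTwistCouplingInSupplySqrtSevenRungs
import Summits.BirchSwinnertonDyer.BirchSwinnertonDyer.Theorems.BiquadraticEisensteinDescentHeegnerTwistCouplingInSupplySqrtSevenCornerHecke
import HarnessLib

set_option linter.dupNamespace false -- `Summit.BirchSwinnertonDyer.BirchSwinnertonDyer.Theorems.…` (summit = sub)
set_option autoImplicit false

/-!
# Crux `HeegnerTwistCouplingInSupply` (stmt-BirchSwinnertonDyer-21381) — the `j = −3375` RUNGS (`p ≡ 1 (mod 4)` inert half) with the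
# Deuring–Hecke binder DISCHARGED: Burungale–Tian + the group order formula of `X₀(49)` only

Sequel to `…SqrtSevenRungs` (w1 g11) and `…SqrtSevenCornerHecke` (this seat).  `…SqrtSevenRungs` proved, for `W⁻_p = ⟨0, −21p, 0, 112p², 0⟩ = X₀(49)^{(−p)}`
(`p ≡ 1 (mod 4)`, `p ≡ 3, 5, 6 (mod 7)`), the generic pin-free rung `rung_of_two_facts` and the eight rungs `255, 615, 663, 1095, 1335, 1455, 1599, 1615`
modulo Burungale–Tian (`hBT`) and the Deuring–Hecke continuation `hH : hasEntireLFunction_of_j_mem_maximalCMJInvariants`, the latter entering only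
through `…SqrtSevenCorner.L_one_ne_zero_A` (to read `r_an(A_n) = 0` as `L(A_n, 1) ≠ 0` on the cell curves, `j = −3375`).  Since
`X049.hasEntireLFunction_of_j_eq_neg3375` (Hecke's weight-one theta series of `ℤ[½(1+√−7)]`, in the kernel) gives that continuation modulo the ONE
printed sign rule `X049.groupOrder_A7` (Silverberg 2010 (2.1) = Rajwade 1977 Thm. 3), the rungs hold modulo Burungale–Tian + `groupOrder_A7`:
this file is `…SqrtSevenRungs` §§2–3 verbatim with `hH` replaced by `hG : X049.groupOrder_A7` (the cell lemma is
`…SqrtSevenCornerHecke.L_one_ne_zero_A_of_groupOrder`; the class numbers `binQF_classNumber_neg…` are reused by name).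

* `rung_of_BT_of_groupOrder` — the generic rung; `rung255_of_groupOrder`, …, `rung1615_of_groupOrder` — the eight rungs.

HONEST FRAMING: rungs on ONE CM family with residual density `2⁻⁸` among the `p ≡ 1 (mod 4)` inert primes; crux 21381 (all CM `W`) is NOT closed;
`C⁺` untouched; the Birch–Swinnerton-Dyer conjecture is not proved by any of this.

## References
* A. Burungale, Y. Tian, Thm. 1.1. [BurungaleTian2026]
* A. Silverberg, Contemp. Math. 521 (2010), (2.1). [Silverberg2010]
* D. A. Cox, *Primes of the form x² + ny²*, 2nd ed. (2013), §2.A Thm. 2.13, §7.B Thm. 7.7(ii). [Cox2013]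
-/

noncomputable section

open scoped Classical NumberField

namespace Summit.BirchSwinnertonDyer.BirchSwinnertonDyer.Theorems.BiquadraticEisensteinDescentHeegnerTwistCouplingInSupplySqrtSevenRungsHecke

open _root_.WeierstrassCurve Literature.NumberTheory.EllipticCurves Literature.NumberTheory
open Literature.NumberTheory.QuadraticFields Literature.NumberTheory.QuadraticFields.Quadratic
open IsDedekindDomain Rat.HeightOneSpectrum
open Summit.BirchSwinnertonDyer.BirchSwinnertonDyer.Theorems.BiquadraticEisensteinDescentHeegnerTwistCouplingInSupplySqrtSevenCell
open Summit.BirchSwinnertonDyer.BirchSwinnertonDyer.Theorems.BiquadraticEisensteinDescentHeegnerTwistCouplingInSupplySqrtSevenCorner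
open Summit.BirchSwinnertonDyer.BirchSwinnertonDyer.Theorems.BiquadraticEisensteinDescentHeegnerTwistCouplingInSupplySqrtSevenRungs
open Summit.BirchSwinnertonDyer.BirchSwinnertonDyer.Theorems.BiquadraticEisensteinDescentHeegnerTwistCouplingInSupplySqrtSevenCornerHecke

/-! ## §2 The generic rung, modulo Burungale–Tian + the group order formula -/

section Rung

/-- ★ **Generic pin-free rung.** Fix primes `q₃ ≡ 3 (mod 8)`, `q₅`, `q₁ ≡ 1 (mod 4)` (all `≡ 3, 5, 6 (mod 7)`, distinct from each other, with
`q₃q₅q₁ ≡ 7 (mod 8)`) and the kernel value `h₀ = h(−q₃q₅q₁)`. Then for every prime `p ≡ 1 (mod 4)` with `(p/7) = −1`, `(−q₃q₅q₁/p) = +1`,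
`h₀ < p` and `p ∉ {q₅, q₁}`, the CONCLUSION of crux 21381 holds for `W = W⁻_p` with `K′ = ℚ(√−q₃q₅q₁)`: `d = −q₃q₅q₁ ≡ 1 (mod 8)` (`2` splits),
`(d/7) = +1` (three non-residues and `(−1/7) = −1`), `(d/p) = +1` (the rung hypothesis), `W⁻_p^{(d)} = A_{q₃·(q₅q₁p)}` in CELL-√7, `h(K′) = h₀ < p`
— modulo Burungale–Tian + the group order formula of `X₀(49)` (`X049.groupOrder_A7`). [cite: BurungaleTian2026, Thm. 1.1] [cite: Silverberg2010, (2.1)]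
[cite: Cox2013, §2.A Thm. 2.13 and §7.B Thm. 7.7(ii)] -/
theorem rung_of_BT_of_groupOrder (hBT : burungaleTian_analyticRank_eq_zero_of_selmerCorank_eq_zero_of_hasCM)
    (hG : X049.groupOrder_A7) {q₃ q₅ q₁ m h₀ : ℕ} (hm : m = q₃ * q₅ * q₁) (hq₃ : q₃.Prime) (hq₅ : q₅.Prime)
    (hq₁ : q₁.Prime) (hq₃8 : q₃ % 8 = 3) (hq₅4 : q₅ % 4 = 1) (hq₁4 : q₁ % 4 = 1) (h8 : m % 8 = 7)
    (hq₃7 : q₃ % 7 = 3 ∨ q₃ % 7 = 5 ∨ q₃ % 7 = 6) (hq₅7 : q₅ % 7 = 3 ∨ q₅ % 7 = 5 ∨ q₅ % 7 = 6) (hq₁7 : q₁ % 7 = 3 ∨ q₁ % 7 = 5 ∨ q₁ % 7 = 6)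
    (hne : q₅ ≠ q₁) (hJ7 : jacobiSym (-(m : ℤ)) 7 = 1) (hh : BinQF.classNumber (-(m : ℤ)) = h₀) :
    ∀ (p : ℕ) [Fact p.Prime], p % 4 = 1 → (p % 7 = 3 ∨ p % 7 = 5 ∨ p % 7 = 6) → jacobiSym (-(m : ℤ)) p = 1 → h₀ < p →
      ∃ (K : Type) (_ : Field K) (_ : NumberField K),
        IsImaginaryQuadratic K ∧ 4 < (NumberField.discr K).natAbs ∧
        SatisfiesHeegnerHypothesis ((⟨0, -21 * (p : ℚ), 0, 112 * (p : ℚ) ^ 2, 0⟩ : WeierstrassCurve ℚ).conductorNorm ℤ) K ∧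
        ((⟨0, -21 * (p : ℚ), 0, 112 * (p : ℚ) ^ 2, 0⟩ : WeierstrassCurve ℚ).quadraticTwist (NumberField.discr K : ℚ)).entireLFunction 1 ≠ 0 ∧
        NumberField.classNumber K < p ∧ ¬ p ∣ NumberField.classNumber K := by
  intro p hpF hp4 hp7 hJp hh₀
  have hp : p.Prime := hpF.out
  haveI := isElliptic_Wneg p hp
  have hm0 : 0 < m := by rw [hm]; exact Nat.mul_pos (Nat.mul_pos hq₃.pos hq₅.pos) hq₁.pos
  -- `p ∤ m` (else the symbol `(−m/p)` would vanish), so `p ≠ q₅, q₁`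
  have hpm : ¬ p ∣ m := fun hdvd => by
    rw [jacobiSym.mod_left, Int.emod_eq_zero_of_dvd ((Int.natCast_dvd_natCast.mpr hdvd).neg_right),
      jacobiSym.zero_left hp.one_lt] at hJp
    exact zero_ne_one hJp
  have hp₅ : p ≠ q₅ := by rintro rfl; exact hpm ⟨q₃ * q₁, by rw [hm]; ring⟩
  have hp₁ : p ≠ q₁ := by rintro rfl; exact hpm ⟨q₃ * q₅, by rw [hm]; ring⟩
  have hmZ' : (0 : ℤ) < m := by exact_mod_cast hm0
  have hmZ : (-(m : ℤ)) < 0 := by linarith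
  haveI : Fact ((-(m : ℤ)) < 0) := ⟨hmZ⟩
  -- the field
  have hq₃5 : q₃ ≠ q₅ := by rintro rfl; omega
  have hq₃1 : q₃ ≠ q₁ := by rintro rfl; omega
  have hc1 : Nat.Coprime (q₃ * q₅) q₁ :=
    Nat.Coprime.mul_left ((Nat.coprime_primes hq₃ hq₁).mpr hq₃1) ((Nat.coprime_primes hq₅ hq₁).mpr hne)
  have hc2 : Nat.Coprime q₃ q₅ := (Nat.coprime_primes hq₃ hq₅).mpr hq₃5
  have hmsq : Squarefree m := by
    rw [hm, Nat.squarefree_mul hc1, Nat.squarefree_mul hc2]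
    exact ⟨⟨hq₃.squarefree, hq₅.squarefree⟩, hq₁.squarefree⟩
  have hsf : Squarefree (-(m : ℤ)).natAbs := by rw [Int.natAbs_neg, Int.natAbs_natCast]; exact hmsq
  have hD8 : (-(m : ℤ)) % 8 = 1 := by omega
  obtain ⟨hK, hdK⟩ := isImaginaryQuadratic_and_discr_sqrtField_of_squarefree_natAbs (-(m : ℤ)) (by omega) hsf
  have hHg : SatisfiesHeegnerHypothesis ((⟨0, -21 * (p : ℚ), 0, 112 * (p : ℚ) ^ 2, 0⟩ : WeierstrassCurve ℚ).conductorNorm ℤ)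
      (sqrtField (-(m : ℤ))) :=
    satisfiesHeegnerHypothesis_sqrtField_of_squarefree_natAbs _ hD8 hsf fun r hr hrN => by
      rcases prime_dvd_conductorNorm_Wneg hp hr hrN with rfl | rfl | rfl
      · exact Or.inl rfl
      · exact Or.inr hJ7
      · exact Or.inr hJp
  have hcl : NumberField.classNumber (sqrtField (-(m : ℤ))) < p := by
    rw [ClassNumberValues.classNumber_eq_of_discr_eq hK.1 hdK hmZ hh]; exact hh₀
  refine ⟨sqrtField (-(m : ℤ)), inferInstance, inferInstance, hK, ?_, hHg, ?_, hcl, fun hdvd =>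
    absurd (Nat.le_of_dvd (NumberField.classNumber_pos _) hdvd) (not_le.mpr hcl)⟩
  · rw [hdK, Int.natAbs_neg, Int.natAbs_natCast, hm]
    have := hq₃.two_le; have := hq₅.two_le; have := hq₁.two_le
    nlinarith [Nat.mul_le_mul (Nat.mul_le_mul hq₃.two_le hq₅.two_le) hq₁.two_le]
  · -- `W⁻_p^{(−m)} = A_{m p} = A_{q₃ · (q₅ q₁ p)}` in CELL-√7
    rw [hdK, quadraticTwist_Wneg, show (m * p : ℕ) = q₃ * (q₅ * q₁ * p) by rw [hm]; ring]
    have hq₃m : ¬ q₃ ∣ q₅ * q₁ * p := by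
      intro h
      rcases (Nat.Prime.dvd_mul hq₃).mp h with h | h
      · rcases (Nat.Prime.dvd_mul hq₃).mp h with h | h
        · exact hq₃5 ((Nat.prime_dvd_prime_iff_eq hq₃ hq₅).mp h)
        · exact hq₃1 ((Nat.prime_dvd_prime_iff_eq hq₃ hq₁).mp h)
      · have := (Nat.prime_dvd_prime_iff_eq hq₃ hp).mp h; omega
    have hm'sq : Squarefree (q₅ * q₁ * p) := by
      rw [Nat.squarefree_mul (Nat.Coprime.mul_left ((Nat.coprime_primes hq₅ hp).mpr (Ne.symm hp₅)) ((Nat.coprime_primes hq₁ hp).mpr (Ne.symm hp₁))),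
        Nat.squarefree_mul ((Nat.coprime_primes hq₅ hq₁).mpr hne)]
      exact ⟨⟨hq₅.squarefree, hq₁.squarefree⟩, hp.squarefree⟩
    have hm' : ∀ r : ℕ, r.Prime → r ∣ q₅ * q₁ * p → r % 4 = 1 ∧ (r % 7 = 3 ∨ r % 7 = 5 ∨ r % 7 = 6) := by
      intro r hr hrd
      rcases (Nat.Prime.dvd_mul hr).mp hrd with h | h
      · rcases (Nat.Prime.dvd_mul hr).mp h with h | h
        · obtain rfl := (Nat.prime_dvd_prime_iff_eq hr hq₅).mp h; exact ⟨hq₅4, hq₅7⟩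
        · obtain rfl := (Nat.prime_dvd_prime_iff_eq hr hq₁).mp h; exact ⟨hq₁4, hq₁7⟩
      · obtain rfl := (Nat.prime_dvd_prime_iff_eq hr hp).mp h; exact ⟨hp4, hp7⟩
    haveI := isElliptic_A (Nat.mul_ne_zero hq₃.ne_zero (Nat.mul_ne_zero (Nat.mul_ne_zero hq₅.ne_zero hq₁.ne_zero) hp.ne_zero))
    exact (L_one_ne_zero_A_of_groupOrder hBT hG hq₃ hq₃8 hq₃7 (Nat.mul_pos (Nat.mul_pos hq₅.pos hq₁.pos) hp.pos) hm'sq hq₃m hm').2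

end Rung

/-! ## §3 The eight rungs, modulo Burungale–Tian + the group order formula -/

section Rungs

/-- ★★ **Rung `255 = 3·5·17`** (`K′ = ℚ(√−255)`, `h = 12`): for every prime `p ≡ 1 (mod 4)`, `p ≡ 3, 5, 6 (mod 7)`, with `(−255/p) = +1` and `p > 12`,
the conclusion of crux 21381 for `W = X₀(49)^{(−p)} = ⟨0, −21p, 0, 112p², 0⟩`, modulo Burungale–Tian + the group order formula of `X₀(49)` (`X049.groupOrder_A7`). [cite: BurungaleTian2026, Thm. 1.1]
[cite: Silverberg2010, (2.1)] -/
theorem rung255_of_groupOrder (hBT : burungaleTian_analyticRank_eq_zero_of_selmerCorank_eq_zero_of_hasCM)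
    (hG : X049.groupOrder_A7) :
    ∀ (p : ℕ) [Fact p.Prime], p % 4 = 1 → (p % 7 = 3 ∨ p % 7 = 5 ∨ p % 7 = 6) → jacobiSym (-255) p = 1 → 12 < p →
      ∃ (K : Type) (_ : Field K) (_ : NumberField K),
        IsImaginaryQuadratic K ∧ 4 < (NumberField.discr K).natAbs ∧
        SatisfiesHeegnerHypothesis ((⟨0, -21 * (p : ℚ), 0, 112 * (p : ℚ) ^ 2, 0⟩ : WeierstrassCurve ℚ).conductorNorm ℤ) K ∧
        ((⟨0, -21 * (p : ℚ), 0, 112 * (p : ℚ) ^ 2, 0⟩ : WeierstrassCurve ℚ).quadraticTwist (NumberField.discr K : ℚ)).entireLFunction 1 ≠ 0 ∧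
        NumberField.classNumber K < p ∧ ¬ p ∣ NumberField.classNumber K := by
  intro p _ hp4 hp7 hJ hh
  exact rung_of_BT_of_groupOrder hBT hG (q₃ := 3) (q₅ := 5) (q₁ := 17) (m := 255) (h₀ := 12) (by norm_num) (by norm_num) (by norm_num)
    (by norm_num) (by norm_num) (by norm_num) (by norm_num) (by norm_num) (by norm_num) (by norm_num) (by norm_num) (by norm_num)
    (by norm_num) (by exact_mod_cast binQF_classNumber_neg255) p hp4 hp7 (by exact_mod_cast hJ) hh

/-- ★★ **Rung `615 = 3·5·41`** (`K′ = ℚ(√−615)`, `h = 20`): for every prime `p ≡ 1 (mod 4)`, `p ≡ 3, 5, 6 (mod 7)`, with `(−615/p) = +1` and `p > 20`,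
the conclusion of crux 21381 for `W = X₀(49)^{(−p)} = ⟨0, −21p, 0, 112p², 0⟩`, modulo Burungale–Tian + the group order formula of `X₀(49)` (`X049.groupOrder_A7`). [cite: BurungaleTian2026, Thm. 1.1]
[cite: Silverberg2010, (2.1)] -/
theorem rung615_of_groupOrder (hBT : burungaleTian_analyticRank_eq_zero_of_selmerCorank_eq_zero_of_hasCM)
    (hG : X049.groupOrder_A7) :
    ∀ (p : ℕ) [Fact p.Prime], p % 4 = 1 → (p % 7 = 3 ∨ p % 7 = 5 ∨ p % 7 = 6) → jacobiSym (-615) p = 1 → 20 < p →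
      ∃ (K : Type) (_ : Field K) (_ : NumberField K),
        IsImaginaryQuadratic K ∧ 4 < (NumberField.discr K).natAbs ∧
        SatisfiesHeegnerHypothesis ((⟨0, -21 * (p : ℚ), 0, 112 * (p : ℚ) ^ 2, 0⟩ : WeierstrassCurve ℚ).conductorNorm ℤ) K ∧
        ((⟨0, -21 * (p : ℚ), 0, 112 * (p : ℚ) ^ 2, 0⟩ : WeierstrassCurve ℚ).quadraticTwist (NumberField.discr K : ℚ)).entireLFunction 1 ≠ 0 ∧
        NumberField.classNumber K < p ∧ ¬ p ∣ NumberField.classNumber K := by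
  intro p _ hp4 hp7 hJ hh
  exact rung_of_BT_of_groupOrder hBT hG (q₃ := 3) (q₅ := 5) (q₁ := 41) (m := 615) (h₀ := 20) (by norm_num) (by norm_num) (by norm_num)
    (by norm_num) (by norm_num) (by norm_num) (by norm_num) (by norm_num) (by norm_num) (by norm_num) (by norm_num) (by norm_num)
    (by norm_num) (by exact_mod_cast binQF_classNumber_neg615) p hp4 hp7 (by exact_mod_cast hJ) hh

/-- ★★ **Rung `663 = 3·13·17`** (`K′ = ℚ(√−663)`, `h = 16`): for every prime `p ≡ 1 (mod 4)`, `p ≡ 3, 5, 6 (mod 7)`, with `(−663/p) = +1` and `p > 16`,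
the conclusion of crux 21381 for `W = X₀(49)^{(−p)} = ⟨0, −21p, 0, 112p², 0⟩`, modulo Burungale–Tian + the group order formula of `X₀(49)` (`X049.groupOrder_A7`). [cite: BurungaleTian2026, Thm. 1.1]
[cite: Silverberg2010, (2.1)] -/
theorem rung663_of_groupOrder (hBT : burungaleTian_analyticRank_eq_zero_of_selmerCorank_eq_zero_of_hasCM)
    (hG : X049.groupOrder_A7) :
    ∀ (p : ℕ) [Fact p.Prime], p % 4 = 1 → (p % 7 = 3 ∨ p % 7 = 5 ∨ p % 7 = 6) → jacobiSym (-663) p = 1 → 16 < p →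
      ∃ (K : Type) (_ : Field K) (_ : NumberField K),
        IsImaginaryQuadratic K ∧ 4 < (NumberField.discr K).natAbs ∧
        SatisfiesHeegnerHypothesis ((⟨0, -21 * (p : ℚ), 0, 112 * (p : ℚ) ^ 2, 0⟩ : WeierstrassCurve ℚ).conductorNorm ℤ) K ∧
        ((⟨0, -21 * (p : ℚ), 0, 112 * (p : ℚ) ^ 2, 0⟩ : WeierstrassCurve ℚ).quadraticTwist (NumberField.discr K : ℚ)).entireLFunction 1 ≠ 0 ∧
        NumberField.classNumber K < p ∧ ¬ p ∣ NumberField.classNumber K := by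
  intro p _ hp4 hp7 hJ hh
  exact rung_of_BT_of_groupOrder hBT hG (q₃ := 3) (q₅ := 13) (q₁ := 17) (m := 663) (h₀ := 16) (by norm_num) (by norm_num) (by norm_num)
    (by norm_num) (by norm_num) (by norm_num) (by norm_num) (by norm_num) (by norm_num) (by norm_num) (by norm_num) (by norm_num)
    (by norm_num) (by exact_mod_cast binQF_classNumber_neg663) p hp4 hp7 (by exact_mod_cast hJ) hh

/-- ★★ **Rung `1095 = 3·5·73`** (`K′ = ℚ(√−1095)`, `h = 28`): for every prime `p ≡ 1 (mod 4)`, `p ≡ 3, 5, 6 (mod 7)`, with `(−1095/p) = +1` and `p > 28`,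
the conclusion of crux 21381 for `W = X₀(49)^{(−p)} = ⟨0, −21p, 0, 112p², 0⟩`, modulo Burungale–Tian + the group order formula of `X₀(49)` (`X049.groupOrder_A7`). [cite: BurungaleTian2026, Thm. 1.1]
[cite: Silverberg2010, (2.1)] -/
theorem rung1095_of_groupOrder (hBT : burungaleTian_analyticRank_eq_zero_of_selmerCorank_eq_zero_of_hasCM)
    (hG : X049.groupOrder_A7) :
    ∀ (p : ℕ) [Fact p.Prime], p % 4 = 1 → (p % 7 = 3 ∨ p % 7 = 5 ∨ p % 7 = 6) → jacobiSym (-1095) p = 1 → 28 < p →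
      ∃ (K : Type) (_ : Field K) (_ : NumberField K),
        IsImaginaryQuadratic K ∧ 4 < (NumberField.discr K).natAbs ∧
        SatisfiesHeegnerHypothesis ((⟨0, -21 * (p : ℚ), 0, 112 * (p : ℚ) ^ 2, 0⟩ : WeierstrassCurve ℚ).conductorNorm ℤ) K ∧
        ((⟨0, -21 * (p : ℚ), 0, 112 * (p : ℚ) ^ 2, 0⟩ : WeierstrassCurve ℚ).quadraticTwist (NumberField.discr K : ℚ)).entireLFunction 1 ≠ 0 ∧
        NumberField.classNumber K < p ∧ ¬ p ∣ NumberField.classNumber K := by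
  intro p _ hp4 hp7 hJ hh
  exact rung_of_BT_of_groupOrder hBT hG (q₃ := 3) (q₅ := 5) (q₁ := 73) (m := 1095) (h₀ := 28) (by norm_num) (by norm_num) (by norm_num)
    (by norm_num) (by norm_num) (by norm_num) (by norm_num) (by norm_num) (by norm_num) (by norm_num) (by norm_num) (by norm_num)
    (by norm_num) (by exact_mod_cast binQF_classNumber_neg1095) p hp4 hp7 (by exact_mod_cast hJ) hh

/-- ★★ **Rung `1335 = 3·5·89`** (`K′ = ℚ(√−1335)`, `h = 28`): for every prime `p ≡ 1 (mod 4)`, `p ≡ 3, 5, 6 (mod 7)`, with `(−1335/p) = +1` and `p > 28`,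
the conclusion of crux 21381 for `W = X₀(49)^{(−p)} = ⟨0, −21p, 0, 112p², 0⟩`, modulo Burungale–Tian + the group order formula of `X₀(49)` (`X049.groupOrder_A7`). [cite: BurungaleTian2026, Thm. 1.1]
[cite: Silverberg2010, (2.1)] -/
theorem rung1335_of_groupOrder (hBT : burungaleTian_analyticRank_eq_zero_of_selmerCorank_eq_zero_of_hasCM)
    (hG : X049.groupOrder_A7) :
    ∀ (p : ℕ) [Fact p.Prime], p % 4 = 1 → (p % 7 = 3 ∨ p % 7 = 5 ∨ p % 7 = 6) → jacobiSym (-1335) p = 1 → 28 < p →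
      ∃ (K : Type) (_ : Field K) (_ : NumberField K),
        IsImaginaryQuadratic K ∧ 4 < (NumberField.discr K).natAbs ∧
        SatisfiesHeegnerHypothesis ((⟨0, -21 * (p : ℚ), 0, 112 * (p : ℚ) ^ 2, 0⟩ : WeierstrassCurve ℚ).conductorNorm ℤ) K ∧
        ((⟨0, -21 * (p : ℚ), 0, 112 * (p : ℚ) ^ 2, 0⟩ : WeierstrassCurve ℚ).quadraticTwist (NumberField.discr K : ℚ)).entireLFunction 1 ≠ 0 ∧
        NumberField.classNumber K < p ∧ ¬ p ∣ NumberField.classNumber K := by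
  intro p _ hp4 hp7 hJ hh
  exact rung_of_BT_of_groupOrder hBT hG (q₃ := 3) (q₅ := 5) (q₁ := 89) (m := 1335) (h₀ := 28) (by norm_num) (by norm_num) (by norm_num)
    (by norm_num) (by norm_num) (by norm_num) (by norm_num) (by norm_num) (by norm_num) (by norm_num) (by norm_num) (by norm_num)
    (by norm_num) (by exact_mod_cast binQF_classNumber_neg1335) p hp4 hp7 (by exact_mod_cast hJ) hh

/-- ★★ **Rung `1455 = 3·5·97`** (`K′ = ℚ(√−1455)`, `h = 28`): for every prime `p ≡ 1 (mod 4)`, `p ≡ 3, 5, 6 (mod 7)`, with `(−1455/p) = +1` and `p > 28`,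
the conclusion of crux 21381 for `W = X₀(49)^{(−p)} = ⟨0, −21p, 0, 112p², 0⟩`, modulo Burungale–Tian + the group order formula of `X₀(49)` (`X049.groupOrder_A7`). [cite: BurungaleTian2026, Thm. 1.1]
[cite: Silverberg2010, (2.1)] -/
theorem rung1455_of_groupOrder (hBT : burungaleTian_analyticRank_eq_zero_of_selmerCorank_eq_zero_of_hasCM)
    (hG : X049.groupOrder_A7) :
    ∀ (p : ℕ) [Fact p.Prime], p % 4 = 1 → (p % 7 = 3 ∨ p % 7 = 5 ∨ p % 7 = 6) → jacobiSym (-1455) p = 1 → 28 < p →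
      ∃ (K : Type) (_ : Field K) (_ : NumberField K),
        IsImaginaryQuadratic K ∧ 4 < (NumberField.discr K).natAbs ∧
        SatisfiesHeegnerHypothesis ((⟨0, -21 * (p : ℚ), 0, 112 * (p : ℚ) ^ 2, 0⟩ : WeierstrassCurve ℚ).conductorNorm ℤ) K ∧
        ((⟨0, -21 * (p : ℚ), 0, 112 * (p : ℚ) ^ 2, 0⟩ : WeierstrassCurve ℚ).quadraticTwist (NumberField.discr K : ℚ)).entireLFunction 1 ≠ 0 ∧
        NumberField.classNumber K < p ∧ ¬ p ∣ NumberField.classNumber K := by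
  intro p _ hp4 hp7 hJ hh
  exact rung_of_BT_of_groupOrder hBT hG (q₃ := 3) (q₅ := 5) (q₁ := 97) (m := 1455) (h₀ := 28) (by norm_num) (by norm_num) (by norm_num)
    (by norm_num) (by norm_num) (by norm_num) (by norm_num) (by norm_num) (by norm_num) (by norm_num) (by norm_num) (by norm_num)
    (by norm_num) (by exact_mod_cast binQF_classNumber_neg1455) p hp4 hp7 (by exact_mod_cast hJ) hh

/-- ★★ **Rung `1599 = 3·13·41`** (`K′ = ℚ(√−1599)`, `h = 36`): for every prime `p ≡ 1 (mod 4)`, `p ≡ 3, 5, 6 (mod 7)`, with `(−1599/p) = +1` and `p > 36`,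
the conclusion of crux 21381 for `W = X₀(49)^{(−p)} = ⟨0, −21p, 0, 112p², 0⟩`, modulo Burungale–Tian + the group order formula of `X₀(49)` (`X049.groupOrder_A7`). [cite: BurungaleTian2026, Thm. 1.1]
[cite: Silverberg2010, (2.1)] -/
theorem rung1599_of_groupOrder (hBT : burungaleTian_analyticRank_eq_zero_of_selmerCorank_eq_zero_of_hasCM)
    (hG : X049.groupOrder_A7) :
    ∀ (p : ℕ) [Fact p.Prime], p % 4 = 1 → (p % 7 = 3 ∨ p % 7 = 5 ∨ p % 7 = 6) → jacobiSym (-1599) p = 1 → 36 < p →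
      ∃ (K : Type) (_ : Field K) (_ : NumberField K),
        IsImaginaryQuadratic K ∧ 4 < (NumberField.discr K).natAbs ∧
        SatisfiesHeegnerHypothesis ((⟨0, -21 * (p : ℚ), 0, 112 * (p : ℚ) ^ 2, 0⟩ : WeierstrassCurve ℚ).conductorNorm ℤ) K ∧
        ((⟨0, -21 * (p : ℚ), 0, 112 * (p : ℚ) ^ 2, 0⟩ : WeierstrassCurve ℚ).quadraticTwist (NumberField.discr K : ℚ)).entireLFunction 1 ≠ 0 ∧
        NumberField.classNumber K < p ∧ ¬ p ∣ NumberField.classNumber K := by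
  intro p _ hp4 hp7 hJ hh
  exact rung_of_BT_of_groupOrder hBT hG (q₃ := 3) (q₅ := 13) (q₁ := 41) (m := 1599) (h₀ := 36) (by norm_num) (by norm_num) (by norm_num)
    (by norm_num) (by norm_num) (by norm_num) (by norm_num) (by norm_num) (by norm_num) (by norm_num) (by norm_num) (by norm_num)
    (by norm_num) (by exact_mod_cast binQF_classNumber_neg1599) p hp4 hp7 (by exact_mod_cast hJ) hh

/-- ★★ **Rung `1615 = 19·5·17`** (`K′ = ℚ(√−1615)`, `h = 24`): for every prime `p ≡ 1 (mod 4)`, `p ≡ 3, 5, 6 (mod 7)`, with `(−1615/p) = +1` and `p > 24`,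
the conclusion of crux 21381 for `W = X₀(49)^{(−p)} = ⟨0, −21p, 0, 112p², 0⟩`, modulo Burungale–Tian + the group order formula of `X₀(49)` (`X049.groupOrder_A7`). [cite: BurungaleTian2026, Thm. 1.1]
[cite: Silverberg2010, (2.1)] -/
theorem rung1615_of_groupOrder (hBT : burungaleTian_analyticRank_eq_zero_of_selmerCorank_eq_zero_of_hasCM)
    (hG : X049.groupOrder_A7) :
    ∀ (p : ℕ) [Fact p.Prime], p % 4 = 1 → (p % 7 = 3 ∨ p % 7 = 5 ∨ p % 7 = 6) → jacobiSym (-1615) p = 1 → 24 < p →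
      ∃ (K : Type) (_ : Field K) (_ : NumberField K),
        IsImaginaryQuadratic K ∧ 4 < (NumberField.discr K).natAbs ∧
        SatisfiesHeegnerHypothesis ((⟨0, -21 * (p : ℚ), 0, 112 * (p : ℚ) ^ 2, 0⟩ : WeierstrassCurve ℚ).conductorNorm ℤ) K ∧
        ((⟨0, -21 * (p : ℚ), 0, 112 * (p : ℚ) ^ 2, 0⟩ : WeierstrassCurve ℚ).quadraticTwist (NumberField.discr K : ℚ)).entireLFunction 1 ≠ 0 ∧
        NumberField.classNumber K < p ∧ ¬ p ∣ NumberField.classNumber K := by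
  intro p _ hp4 hp7 hJ hh
  exact rung_of_BT_of_groupOrder hBT hG (q₃ := 19) (q₅ := 5) (q₁ := 17) (m := 1615) (h₀ := 24) (by norm_num) (by norm_num) (by norm_num)
    (by norm_num) (by norm_num) (by norm_num) (by norm_num) (by norm_num) (by norm_num) (by norm_num) (by norm_num) (by norm_num)
    (by norm_num) (by exact_mod_cast binQF_classNumber_neg1615) p hp4 hp7 (by exact_mod_cast hJ) hh

end Rungs

end Summit.BirchSwinnertonDyer.BirchSwinnertonDyer.Theorems.BiquadraticEisensteinDescentHeegnerTwistCouplingInSupplySqrtSevenRungsHecke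

end
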